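import Summits.AtomisticToContinuum.FouriersLaw.Theses.PorousMediumCorner
import HarnessLib

/-!
# BC3 birth skeleton of the piece `AnchorLowFrequencyWindow` (child of the split of `PorousMediumCorner.AnchorAbelGreenKubo`, stmt-AtomisticToContinuum-9790)

Seam: a low-frequency window with a CONTINUOUS density is what Fourier inversion delivers when the reduced autocorrelation
`C(t) − σ{0}` (the cosine transform of `σ − σ{0}·δ₀`) is absolutely integrable on `(0, ∞)` (stub 2, harmonic analysis,
provable now: an even finite measure whose Fourier–Stieltjes transform is in `L¹` has a continuous density — here even
globally, `g(ω) = π⁻¹ ∫₀^∞ (C(t) − σ{0}) cos(ωt) dt`); the physics is the time-domain decay statement (stub 1: the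
connected-to-Drude part of the summed current autocorrelation of the anchor is integrable — the expected tail is `t^{−3/2}`,
one conserved field, momentum not conserved).

`AnchorLowFrequencyWindow` below is a LOCAL copy of the child's statement (byte-identical with children.json / the registered stub
`stub_anchorLowFrequencyWindow` of `Lines/spectral_trichotomy.lean`); after the split it is the route decl
`Summit.AtomisticToContinuum.FouriersLaw.Theses.PorousMediumCorner.AnchorLowFrequencyWindow` and `AnchorLowFrequencyWindow_of` retargets to it by name.
lean check: rc 0, sorries = the two stubs, `AnchorLowFrequencyWindow_of` uses the stubs BY NAME.
-/

noncomputable section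

namespace Summit.AtomisticToContinuum.FouriersLaw.Cruxes.AnchorAbelGreenKubo.BirthLowFrequencyWindow

open MeasureTheory Filter Set Topology
open scoped ENNReal NNReal

/-- Local copy of the piece (see the module docstring). -/
def AnchorLowFrequencyWindow : Prop :=
  ∀ μ γ : ℝ, 0 < μ → ∀ (ρ : MeasureTheory.Measure Literature.MathematicalPhysics.KineticTheory.HeatConduction.ChainConfig) (D : Literature.MathematicalPhysics.KineticTheory.HeatConduction.InfiniteChainDynamics (Literature.MathematicalPhysics.KineticTheory.HeatConduction.OscillatorChain.mk (fun q => μ * q ^ 4 / 4) (fun r => r ^ 4 / 4) γ)), (Literature.MathematicalPhysics.KineticTheory.HeatConduction.OscillatorChain.mk (fun q => μ * q ^ 4 / 4) (fun r => r ^ 4 / 4) γ).IsChainGibbsMeasure 1 ρ → (∀ x : ℤ, MeasureTheory.MeasurePreserving (fun σ : Literature.MathematicalPhysics.KineticTheory.HeatConduction.ChainConfig => fun i : ℤ => σ (i + x)) ρ ρ) → D.PreservesMeasure ρ → (∀ t : ℝ, D.HasAbsConvergentCorrelation ρ t) → ∀ σ : MeasureTheory.Measure ℝ, MeasureTheory.IsFiniteMeasure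 σ → MeasureTheory.Measure.map (fun ω : ℝ => -ω) σ = σ → (∀ t : ℝ, D.currentCorrelation ρ t = MeasureTheory.integral σ (fun ω : ℝ => Real.cos (ω * t))) → ∃ (δ : ℝ) (g : ℝ → ℝ), 0 < δ ∧ ContinuousOn g (Set.Ioo (-δ) δ) ∧ (∀ ω ∈ Set.Ioo (-δ) δ, 0 ≤ g ω) ∧ σ.restrict (Set.Ioo (-δ) δ) = σ {0} • MeasureTheory.Measure.dirac 0 + (MeasureTheory.volume.restrict (Set.Ioo (-δ) δ)).withDensity (fun ω => ENNReal.ofReal (g ω))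

/-- **Stub 1 (physics; integrable decay of the reduced autocorrelation).** For every admissible EVEN representation
`(ρ, D, σ)` of the anchor at `T = 1`, `t ↦ C(t) − σ{0}` is integrable on `(0, ∞)`. [cite: AokiLukkarinenSpohn2006, §2 eq. (2.6)] -/
theorem stub_reducedCorrelationIntegrable :
    ∀ μ γ : ℝ, 0 < μ → ∀ (ρ : MeasureTheory.Measure Literature.MathematicalPhysics.KineticTheory.HeatConduction.ChainConfig) (D : Literature.MathematicalPhysics.KineticTheory.HeatConduction.InfiniteChainDynamics (Literature.MathematicalPhysics.KineticTheory.HeatConduction.OscillatorChain.mk (fun q => μ * q ^ 4 / 4) (fun r => r ^ 4 / 4) γ)), (Literature.MathematicalPhysics.KineticTheory.HeatConduction.OscillatorChain.mk (fun q => μ * q ^ 4 / 4) (fun r => r ^ 4 / 4) γ).IsChainGibbsMeasure 1 ρ → (∀ x : ℤ, MeasureTheory.MeasurePreserving (fun σ : Literature.MathematicalPhysics.KineticTheory.HeatConduction.ChainConfig => fun i : ℤ => σ (i + x)) ρ ρ) → D.PreservesMeasure ρ → (∀ t : ℝ, D.HasAbsConvergentCorrelation ρ t) → ∀ σ : MeasureTheory.Measure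 ℝ, MeasureTheory.IsFiniteMeasure σ → MeasureTheory.Measure.map (fun ω : ℝ => -ω) σ = σ →
        (∀ t : ℝ, D.currentCorrelation ρ t = MeasureTheory.integral σ (fun ω : ℝ => Real.cos (ω * t))) →
        MeasureTheory.IntegrableOn (fun t : ℝ => D.currentCorrelation ρ t - (σ {0}).toReal) (Set.Ioi (0:ℝ)) := by
  sorry

/-- **Stub 2 (harmonic analysis; Fourier inversion for measures, provable now).** A finite even measure `σ` on `ℝ` whose
cosine transform minus its atom at `0` is integrable on `(0, ∞)` is `σ{0}·δ₀ +` a measure with a continuous non-negative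
density (globally; a fortiori on a window). [folklore] -/
theorem stub_window_of_integrableReducedCorrelation :
    ∀ (σ : MeasureTheory.Measure ℝ) (C : ℝ → ℝ), MeasureTheory.IsFiniteMeasure σ → MeasureTheory.Measure.map (fun ω : ℝ => -ω) σ = σ →
      (∀ t : ℝ, C t = MeasureTheory.integral σ (fun ω : ℝ => Real.cos (ω * t))) →
      MeasureTheory.IntegrableOn (fun t : ℝ => C t - (σ {0}).toReal) (Set.Ioi (0:ℝ)) →
      ∃ (δ : ℝ) (g : ℝ → ℝ), 0 < δ ∧ ContinuousOn g (Set.Ioo (-δ) δ) ∧ (∀ ω ∈ Set.Ioo (-δ) δ, 0 ≤ g ω) ∧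
        σ.restrict (Set.Ioo (-δ) δ) = σ {0} • MeasureTheory.Measure.dirac 0 +
          (MeasureTheory.volume.restrict (Set.Ioo (-δ) δ)).withDensity (fun ω => ENNReal.ofReal (g ω)) := by
  sorry

/-- **`AnchorLowFrequencyWindow_of`**: the two stubs give the piece. [folklore] -/
theorem AnchorLowFrequencyWindow_of : AnchorLowFrequencyWindow := by
  intro μ γ hμ ρ D hG hS hP hA σ hfin heven hC
  exact stub_window_of_integrableReducedCorrelation σ (D.currentCorrelation ρ) hfin heven hC
    (stub_reducedCorrelationIntegrable μ γ hμ ρ D hG hS hP hA σ hfin heven hC)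

end Summit.AtomisticToContinuum.FouriersLaw.Cruxes.AnchorAbelGreenKubo.BirthLowFrequencyWindow

end
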